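import Mathlib
import Summits.Ventures.PercRepro2.CrossAPrimeAvoidCrux

/-!
# The set-avoidance crux at its own constant `ν_P = P(K ∩ P = ∅ | Q)`
(blind cell PercRepro2, p5 g36; S4 §2.4 (s) addendum 40 (3))

`CrossAPrimeAvoidCrux.avoid_crux_nonneg` is the crux for the route function `1[K ∩ P = ∅]` at
the constant `c = 1`.  The constant functional is increasing in `c`, and the smallest admissible
constant for this route function is its `Q`-mean `ν_P = s / Z` (`s = P(Q_P)`, `Z = P(Q)`).
**`avoid_crux_nonneg_nu`**: `2·Z²·τ − Z·y·u − Z·x·w + s·x·y ≥ 0`, i.e. `Z · crossC(ν_P) ≥ 0`.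
The proof is the identity
`s·(2Z²τ − Zyu − Zxw + sxy) = 2sZ²τ − uwZ² + (sx − uZ)(sy − wZ)`
with BHK under the avoidance of `{a₁} ∪ P` (`u·w ≤ τ·s`: the first factor is `≥ uwZ²`) and BHK
for the membership of `o` (resp. `b`) against the hitting of `P` under `Q` (`u·Z ≤ x·s`,
`w·Z ≤ y·s`: both factors of the product are `≥ 0`) — the three facts of `avoid_crux_nonneg`,
re-derived here as the standalone lemmas `bhk_avoid_pair`, `bhk_hit_o`, `bhk_hit_b`.  In the
language of S4 addendum 40 (3) (c): `2E₁[t] − E₁[x]E₁[y] ≥ uw/s² ≥ 0` and `E₀ ≥ E₁` — for the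
avoidance route function the «half positive association» holds because BHK gives positive
association under avoidance.  Own work; standard axioms.
-/

namespace Summit.Ventures.PercRepro2

open CrossAPrimeAvoidCrux

namespace CrossAPrimeAvoidCruxNu

variable {V : Type*} {E : Type*} [Fintype E] [DecidableEq E] [Fintype V] [DecidableEq V]
  {R : Type*} [Field R] [LinearOrder R] [IsStrictOrderedRing R]
variable {ends : E → Sym2 V}

/-- BHK under the avoidance of `{a₁} ∪ P`: `u·w ≤ τ·s`. -/
lemma bhk_avoid_pair (p : E → R) (hp : IsProbVec p) (ends : E → Sym2 V) (o a₁ a₂ b : V)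
    (P : Finset V) :
    prob p (avoidAll ends a₂ (insert a₁ P) ∩ connEvent ends a₂ o) *
        prob p (avoidAll ends a₂ (insert a₁ P) ∩ connEvent ends a₂ b) ≤
      prob p (avoidAll ends a₂ (insert a₁ P) ∩ (connEvent ends a₂ o ∩ connEvent ends a₂ b)) *
        prob p (avoidAll ends a₂ (insert a₁ P)) := by
  have key := bhk_same_cluster_events_avoid p hp ends a₂ (insert a₁ P)
    (isUpperSet_mem_set (V := V) o) (isUpperSet_mem_set (V := V) b)
  rw [← connEvent_eq_clusterInEvent_mem, ← connEvent_eq_clusterInEvent_mem,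
    ← connEvent_inter_eq_clusterInEvent_mem, Set.inter_comm (connEvent ends a₂ o),
    Set.inter_comm (connEvent ends a₂ b), Set.inter_comm (connEvent ends a₂ o ∩ _)] at key
  exact key

/-- BHK for the membership of `z` against the hitting of `P` under `Q`: `u·Z ≤ x·s`. -/
lemma bhk_hit (p : E → R) (hp : IsProbVec p) (ends : E → Sym2 V) (z a₁ a₂ : V)
    (P : Finset V) :
    prob p (avoidAll ends a₂ (insert a₁ P) ∩ connEvent ends a₂ z) *
        prob p (avoidAll ends a₂ {a₁}) ≤
      prob p (avoidAll ends a₂ {a₁} ∩ connEvent ends a₂ z) *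
        prob p (avoidAll ends a₂ (insert a₁ P)) := by
  classical
  have key := bhk_same_cluster_events_avoid p hp ends a₂ {a₁}
    (isUpperSet_mem_set (V := V) z) (isUpperSet_hits (V := V) P)
  rw [← connEvent_eq_clusterInEvent_mem, Set.inter_comm (connEvent ends a₂ z)] at key
  have e1 := prob_split_hits p ends a₁ a₂ P Set.univ
  have e2 := prob_split_hits p ends a₁ a₂ P (connEvent ends a₂ z)
  simp only [Set.inter_univ] at e1 e2
  have c1 : clusterInEvent ends a₂ {S : Set V | ∃ z ∈ P, z ∈ S} ∩ avoidAll ends a₂ {a₁} =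
      avoidAll ends a₂ {a₁} ∩ clusterInEvent ends a₂ {S : Set V | ∃ z ∈ P, z ∈ S} :=
    Set.inter_comm _ _
  have c2 : clusterInEvent ends a₂ ({A : Set V | z ∈ A} ∩ {A : Set V | ∃ z ∈ P, z ∈ A}) ∩
      avoidAll ends a₂ {a₁} =
      avoidAll ends a₂ {a₁} ∩ connEvent ends a₂ z ∩
        clusterInEvent ends a₂ {S : Set V | ∃ z ∈ P, z ∈ S} := by
    ext ω
    simp only [Set.mem_inter_iff, mem_clusterInEvent, Set.mem_setOf_eq, connEvent, cluster]
    tauto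
  rw [c1, c2] at key
  have hH : prob p (avoidAll ends a₂ {a₁} ∩ clusterInEvent ends a₂ {S : Set V | ∃ z ∈ P, z ∈ S}) =
      prob p (avoidAll ends a₂ {a₁}) - prob p (avoidAll ends a₂ (insert a₁ P)) := by
    linarith [e1]
  have hM : prob p (avoidAll ends a₂ {a₁} ∩ connEvent ends a₂ z ∩
      clusterInEvent ends a₂ {S : Set V | ∃ z ∈ P, z ∈ S}) =
      prob p (avoidAll ends a₂ {a₁} ∩ connEvent ends a₂ z) -
        prob p (avoidAll ends a₂ (insert a₁ P) ∩ connEvent ends a₂ z) := by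
    linarith [e2]
  rw [hH, hM] at key
  nlinarith [key]

/-- **The set-avoidance crux at its own constant** `ν_P = s / Z`: with `Z = P(Q)`, `s = P(Q_P)`,
`x, y` the `Q`-memberships of `o, b`, `u, w, τ` the `Q_P`-memberships,
`2·Z²·τ − Z·y·u − Z·x·w + s·x·y ≥ 0` (this is `Z · crossC(ν_P)`). -/
theorem avoid_crux_nonneg_nu (p : E → R) (hp : IsProbVec p) (ends : E → Sym2 V) (o a₁ a₂ b : V)
    (P : Finset V) :
    0 ≤ 2 * prob p (avoidAll ends a₂ {a₁}) * prob p (avoidAll ends a₂ {a₁}) *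
          prob p (avoidAll ends a₂ (insert a₁ P) ∩ (connEvent ends a₂ o ∩ connEvent ends a₂ b)) -
        prob p (avoidAll ends a₂ {a₁}) * prob p (avoidAll ends a₂ {a₁} ∩ connEvent ends a₂ b) *
          prob p (avoidAll ends a₂ (insert a₁ P) ∩ connEvent ends a₂ o) -
        prob p (avoidAll ends a₂ {a₁}) * prob p (avoidAll ends a₂ {a₁} ∩ connEvent ends a₂ o) *
          prob p (avoidAll ends a₂ (insert a₁ P) ∩ connEvent ends a₂ b) +
        prob p (avoidAll ends a₂ (insert a₁ P)) *
          prob p (avoidAll ends a₂ {a₁} ∩ connEvent ends a₂ o) *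
          prob p (avoidAll ends a₂ {a₁} ∩ connEvent ends a₂ b) := by
  classical
  set Z := prob p (avoidAll ends a₂ {a₁}) with hZdef
  set s := prob p (avoidAll ends a₂ (insert a₁ P)) with hsdef
  set x := prob p (avoidAll ends a₂ {a₁} ∩ connEvent ends a₂ o) with hxdef
  set y := prob p (avoidAll ends a₂ {a₁} ∩ connEvent ends a₂ b) with hydef
  set u := prob p (avoidAll ends a₂ (insert a₁ P) ∩ connEvent ends a₂ o) with hudef
  set w := prob p (avoidAll ends a₂ (insert a₁ P) ∩ connEvent ends a₂ b) with hwdef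
  set τ := prob p (avoidAll ends a₂ (insert a₁ P) ∩ (connEvent ends a₂ o ∩ connEvent ends a₂ b))
    with hτdef
  have h1 : u * w ≤ τ * s := bhk_avoid_pair p hp ends o a₁ a₂ b P
  have h2 : u * Z ≤ x * s := bhk_hit p hp ends o a₁ a₂ P
  have h3 : w * Z ≤ y * s := bhk_hit p hp ends b a₁ a₂ P
  have hs0 : 0 ≤ s := prob_nonneg hp _
  have hZ0 : 0 ≤ Z := prob_nonneg hp _
  have hu0 : 0 ≤ u := prob_nonneg hp _
  have hw0 : 0 ≤ w := prob_nonneg hp _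
  have hτ0 : 0 ≤ τ := prob_nonneg hp _
  have hus : u ≤ s := prob_mono hp Set.inter_subset_left
  have hws : w ≤ s := prob_mono hp Set.inter_subset_left
  have hτs : τ ≤ s := prob_mono hp Set.inter_subset_left
  -- the identity `s·E = 2sZ²τ − uwZ² + (sx − uZ)(sy − wZ)`
  have key : s * (2 * Z * Z * τ - Z * y * u - Z * x * w + s * x * y) =
      2 * s * Z * Z * τ - u * w * Z * Z + (x * s - u * Z) * (y * s - w * Z) := by ring
  have hA : u * w * Z * Z ≤ s * Z * Z * τ := by
    have := mul_le_mul_of_nonneg_right h1 (mul_nonneg hZ0 hZ0)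
    nlinarith [this]
  have hB : 0 ≤ (x * s - u * Z) * (y * s - w * Z) :=
    mul_nonneg (by linarith) (by linarith)
  have hsE : 0 ≤ s * (2 * Z * Z * τ - Z * y * u - Z * x * w + s * x * y) := by
    rw [key]
    nlinarith [hA, hB, mul_nonneg (mul_nonneg hs0 (mul_nonneg hZ0 hZ0)) hτ0]
  rcases lt_or_eq_of_le hs0 with hs | hs
  · exact nonneg_of_mul_nonneg_right (by linarith [hsE]) hs
  · -- `s = 0` forces `u = w = τ = 0`
    have hu : u = 0 := le_antisymm (by linarith) hu0
    have hw : w = 0 := le_antisymm (by linarith) hw0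
    have hτ : τ = 0 := le_antisymm (by linarith) hτ0
    rw [← hs, hu, hw, hτ]
    ring_nf
    exact le_rfl

end CrossAPrimeAvoidCruxNu

end Summit.Ventures.PercRepro2
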